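import Literature.AlgebraicGeometry.Resolution.AlterationsSemiStableCodimTwoBlowupFibreModels
import HarnessLib

/-!
# `WildQuotients.SummitReduction` (stmt-ResolutionOfSingularities-16324), line `FramePerfect`:
# the fibre local ring of a base change is a localisation of `κ' ⊗_κ B` — algebra lemmas for stub `stub_pair_quasiSplitBaseChange`

Route `ResolutionOfSingularities/WildQuotients`, crux `SummitReduction`; fourth helper file of stub
`stub_pair_quasiSplitBaseChange` (quasi-splitness of a semi-stable curve is stable under base
change; de Jong 1997, 5.7 and p. 614–615) of the line skeleton
`Cruxes/SummitReduction/Lines/FramePerfect.lean` (v8). Pure commutative algebra, hypothesis-free, for the scheme-to-algebra transfer (SCH): in the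
situation of a point `x'` of `X ×_Y Y'` over `x ∈ X`, `y' ∈ Y'`, `y ∈ Y`, with local rings
`O' = 𝒪_{x'}`, `O = 𝒪_x`, `R' = 𝒪_{y'}`, `R = 𝒪_y`, sections `C = Γ(X,U)`, `A' = Γ(Y',V')`,
`A = Γ(Y,V)` of affine charts (`O = C_𝔮`, `R' = A'_𝔭'`, `O' = (C ⊗_A A')_𝔗` compatibly), residue
fields `κ`, `κ'` and fibre rings `B = O/𝔪_R O`, `B' = O'/𝔪_{R'} O'`:

* `isLocalization_atPrime_of_generators` — an abstract localisation criterion along `S → T → L`;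
* `exists_isLocalization_fibreRing` — **`B'` is the localisation of `κ' ⊗_κ B` at the extended
  ideal `𝔫(κ' ⊗_κ B)` of `𝔫 = 𝔪_O B`, provided that ideal is maximal** (it is when `B^ ≅ κ⟦u,v⟧/(uv)`:
  `isMaximal_map_tensorInr_of_completion_equiv`), by the ring map `k' ⊗ b ↦ k' b`;
* `exists_adicCompletion_fibreRing_equiv` — hence **`(B')^ ≅ (κ' ⊗_κ B)^_{𝔫(κ' ⊗_κ B)}` compatibly
  with `κ'`** (`adicCompletionEquivOfIsLocalizationAtMaximal`), so any presentation
  `(κ' ⊗_κ B)^ ≅ Λ` over `κ'` transfers to `(B')^ ≅ Λ` over `κ'`;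
* bookkeeping: `fibreRing_β_algebraMap`, `exists_fibreRing_hom`, `exists_fibreRing_g`,
  `fibreRing_generators`, `fibreRing_comm` (the maps `h : κ' ⊗_κ B → B'`, `g : C ⊗_A A' → κ' ⊗_κ B`
  and the generation of `κ' ⊗_κ B` by `C ⊗_A A'` up to denominators).
-/

set_option linter.dupNamespace false

noncomputable section

open TensorProduct IsLocalRing
open Literature.AlgebraicGeometry.Resolution

namespace Summit.ResolutionOfSingularities.ResolutionOfSingularities.Theorems

universe u

/-! ## An abstract localisation criterion -/

section Criterion

/-- **Localisation criterion along `S → T → L`.** Let `g : S → T`, `T → L`, `N ⊆ S` a submonoid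
and `P ⊆ T` a prime with: `g(N) ∩ P = ∅`; every `t ∈ T` and every `l ∈ L` is a fraction with
numerator from `S` and denominator from `N`; `g(s) ↦ 0 ∈ L` forces `g(v s) = 0` for some `v ∈ N`;
and `T ∖ P` maps to units. Then `L = T_P`. [folklore] -/
theorem isLocalization_atPrime_of_generators {S T L : Type u} [CommRing S] [CommRing T] [CommRing L]
    [Algebra T L] (g : S →+* T) (N : Submonoid S) (P : Ideal T) [P.IsPrime]
    (ha : ∀ s ∈ N, g s ∉ P)
    (hb : ∀ t : T, ∃ s : S, ∃ u ∈ N, t * g u = g s)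
    (hc : ∀ l : L, ∃ s : S, ∃ u ∈ N, l * algebraMap T L (g u) = algebraMap T L (g s))
    (hd : ∀ s : S, algebraMap T L (g s) = 0 → ∃ v ∈ N, g (v * s) = 0)
    (he : ∀ t ∉ P, IsUnit (algebraMap T L t)) :
    IsLocalization.AtPrime L P where
  map_units := fun ⟨t, ht⟩ => he t ht
  surj := fun l => by
    obtain ⟨s, u, hu, h⟩ := hc l
    exact ⟨(g s, ⟨g u, ha u hu⟩), h⟩
  exists_of_eq := fun {t₁ t₂} h => by
    obtain ⟨s, u, hu, hsu⟩ := hb (t₁ - t₂)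
    have h0 : algebraMap T L (g s) = 0 := by
      rw [← hsu, map_mul, map_sub, h, sub_self, zero_mul]
    obtain ⟨v, hv, hvs⟩ := hd s h0
    refine ⟨⟨g (v * u), ha _ (N.mul_mem hv hu)⟩, ?_⟩
    have h1 : g (v * u) * (t₁ - t₂) = 0 := by
      rw [map_mul, mul_assoc, mul_comm (g u), hsu, ← map_mul, hvs]
    rwa [mul_sub, sub_eq_zero] at h1

end Criterion

/-! ## The fibre ring of a base change -/

section FibreRing

variable {A C A' : Type u} [CommRing A] [CommRing C] [CommRing A'] [Algebra A C] [Algebra A A']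
  {R O R' O' : Type u} [CommRing R] [CommRing O] [CommRing R'] [CommRing O']
  (φ : R →+* O) (ρ : R →+* R') (φ' : R' →+* O') (π : O →+* O')
  (γA : A →+* R) (γC : C →+* O) (γA' : A' →+* R') (σ : C ⊗[A] A' →+* O')
  {κ κ' B B' : Type u} [CommRing κ] [CommRing κ'] [CommRing B] [CommRing B']
  [Algebra κ κ'] [Algebra κ B] [Algebra κ' B'] [Algebra κ B'] [IsScalarTower κ κ' B']
  (mkκ : R →+* κ) (mkκ' : R' →+* κ') (mkB : O →+* B) (mkB' : O' →+* B') (β : B →+* B')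
  (hsq : ∀ r, φ' (ρ r) = π (φ r))
  (h0a : ∀ a, γC (algebraMap A C a) = φ (γA a)) (h0b : ∀ a, γA' (algebraMap A A' a) = ρ (γA a))
  (h1 : ∀ c, σ (c ⊗ₜ 1) = π (γC c)) (h2 : ∀ a', σ (1 ⊗ₜ a') = φ' (γA' a'))
  (hO : ∀ o : O, ∃ c₁ c₂ : C, IsUnit (γC c₂) ∧ o * γC c₂ = γC c₁)
  (hR' : ∀ r : R', ∃ a₁ a₂ : A', IsUnit (γA' a₂) ∧ r * γA' a₂ = γA' a₁)
  (hO'₁ : ∀ o : O', ∃ s u, IsUnit (σ u) ∧ o * σ u = σ s)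
  (hO'₂ : ∀ (I : Ideal (C ⊗[A] A')) (s), σ s ∈ I.map σ → ∃ u, IsUnit (σ u) ∧ u * s ∈ I)
  (hmkκ : Function.Surjective mkκ) (hmkκ' : Function.Surjective mkκ')
  (hmkB : Function.Surjective mkB) (hmkB' : Function.Surjective mkB')
  (hκκ' : ∀ r, algebraMap κ κ' (mkκ r) = mkκ' (ρ r)) (hκB : ∀ r, algebraMap κ B (mkκ r) = mkB (φ r))
  (hικ' : ∀ r', algebraMap κ' B' (mkκ' r') = mkB' (φ' r')) (hβ : ∀ o, β (mkB o) = mkB' (π o))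

include hsq hmkκ hκκ' hκB hικ' hβ in
/-- `β : B → B'` is `κ`-linear. [folklore] -/
theorem fibreRing_β_algebraMap (k : κ) : β (algebraMap κ B k) = algebraMap κ B' k := by
  obtain ⟨r, rfl⟩ := hmkκ k
  rw [hκB, hβ, ← hsq, ← hικ', ← hκκ', IsScalarTower.algebraMap_apply κ κ' B']

include hsq hmkκ hκκ' hκB hικ' hβ in
/-- The ring map `h : κ' ⊗_κ B → B'`, `k' ⊗ b ↦ k' β(b)`. [folklore] -/
theorem exists_fibreRing_hom :
    ∃ h : κ' ⊗[κ] B →+* B', ∀ k b, h (k ⊗ₜ b) = algebraMap κ' B' k * β b := by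
  let βa : B →ₐ[κ] B' :=
    { β with commutes' := fibreRing_β_algebraMap φ ρ φ' π mkκ mkκ' mkB mkB' β hsq hmkκ hκκ' hκB hικ' hβ }
  refine ⟨(Algebra.TensorProduct.lift (IsScalarTower.toAlgHom κ κ' B') βa
    fun _ _ => Commute.all _ _).toRingHom, fun k b => ?_⟩
  rw [AlgHom.toRingHom_eq_coe, RingHom.coe_coe, Algebra.TensorProduct.lift_tmul]
  rfl

include h0a h0b hκκ' hκB in
/-- The ring map `g : C ⊗_A A' → κ' ⊗_κ B`, `c ⊗ a' ↦ ā' ⊗ c̄`. [folklore] -/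
theorem exists_fibreRing_g :
    ∃ g : C ⊗[A] A' →+* κ' ⊗[κ] B, ∀ c a', g (c ⊗ₜ a') = mkκ' (γA' a') ⊗ₜ mkB (γC c) := by
  letI : Algebra A (κ' ⊗[κ] B) := ((algebraMap κ (κ' ⊗[κ] B)).comp (mkκ.comp γA)).toAlgebra
  have halg : ∀ a, algebraMap A (κ' ⊗[κ] B) a = algebraMap κ (κ' ⊗[κ] B) (mkκ (γA a)) := fun _ => rfl
  let gC : C →ₐ[A] κ' ⊗[κ] B :=
    { (tensorInr κ κ' B).comp (mkB.comp γC) with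
      commutes' := fun a => by
        simp only [RingHom.toMonoidHom_eq_coe, OneHom.toFun_eq_coe, MonoidHom.toOneHom_coe,
          MonoidHom.coe_coe, RingHom.coe_comp, Function.comp_apply, tensorInr_apply]
        rw [h0a, ← hκB, halg, Algebra.TensorProduct.algebraMap_apply' (R := κ)] }
  let gA' : A' →ₐ[A] κ' ⊗[κ] B :=
    { (Algebra.TensorProduct.includeLeftRingHom : κ' →+* κ' ⊗[κ] B).comp (mkκ'.comp γA') with
      commutes' := fun a => by
        simp only [RingHom.toMonoidHom_eq_coe, OneHom.toFun_eq_coe, MonoidHom.toOneHom_coe,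
          MonoidHom.coe_coe, RingHom.coe_comp, Function.comp_apply,
          Algebra.TensorProduct.includeLeftRingHom_apply]
        rw [h0b, ← hκκ', halg, Algebra.TensorProduct.algebraMap_apply (R := κ)] }
  refine ⟨(Algebra.TensorProduct.lift gC gA' fun _ _ => Commute.all _ _).toRingHom, fun c a' => ?_⟩
  rw [AlgHom.toRingHom_eq_coe, RingHom.coe_coe, Algebra.TensorProduct.lift_tmul]
  change ((1 : κ') ⊗ₜ[κ] mkB (γC c)) * (mkκ' (γA' a') ⊗ₜ[κ] (1 : B)) = _
  rw [Algebra.TensorProduct.tmul_mul_tmul, one_mul, mul_one]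

include h1 h2 hO hR' hmkκ' hmkB in
/-- **`κ' ⊗_κ B` is generated by `C ⊗_A A'` up to denominators mapping to units of `O'`**: every
element is `g(s)/g(u)` with `σ(u)` a unit. [folklore] -/
theorem fibreRing_generators (g : C ⊗[A] A' →+* κ' ⊗[κ] B)
    (hg : ∀ c a', g (c ⊗ₜ a') = mkκ' (γA' a') ⊗ₜ mkB (γC c)) (t : κ' ⊗[κ] B) :
    ∃ s u : C ⊗[A] A', IsUnit (σ u) ∧ t * g u = g s := by
  induction t using TensorProduct.induction_on with
  | zero => exact ⟨0, 1, by rw [map_one]; exact isUnit_one, by rw [zero_mul, map_zero]⟩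
  | tmul k b =>
    obtain ⟨r', rfl⟩ := hmkκ' k
    obtain ⟨o, rfl⟩ := hmkB b
    obtain ⟨a₁, a₂, ha₂, hr⟩ := hR' r'
    obtain ⟨c₁, c₂, hc₂, ho⟩ := hO o
    refine ⟨c₁ ⊗ₜ a₁, c₂ ⊗ₜ a₂, ?_, ?_⟩
    · have e : (c₂ ⊗ₜ[A] a₂ : C ⊗[A] A') = (c₂ ⊗ₜ[A] (1 : A')) * ((1 : C) ⊗ₜ[A] a₂) := by
        rw [Algebra.TensorProduct.tmul_mul_tmul, mul_one, one_mul]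
      rw [e, map_mul, h1, h2]
      exact (hc₂.map π).mul (ha₂.map φ')
    · rw [hg, hg, Algebra.TensorProduct.tmul_mul_tmul, ← map_mul, ← map_mul, hr, ho]
  | add x y hx hy =>
    obtain ⟨s₁, u₁, hu₁, e₁⟩ := hx
    obtain ⟨s₂, u₂, hu₂, e₂⟩ := hy
    refine ⟨s₁ * u₂ + s₂ * u₁, u₁ * u₂, by rw [map_mul]; exact hu₁.mul hu₂, ?_⟩
    rw [map_mul, add_mul, map_add, map_mul, map_mul, ← e₁, ← e₂]
    ring

include h1 h2 hικ' hβ in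
omit [Algebra κ B'] [IsScalarTower κ κ' B'] in
/-- `σ` followed by `O' → B'` is `g` followed by `h`. [folklore] -/
theorem fibreRing_comm (g : C ⊗[A] A' →+* κ' ⊗[κ] B)
    (hg : ∀ c a', g (c ⊗ₜ a') = mkκ' (γA' a') ⊗ₜ mkB (γC c)) (h : κ' ⊗[κ] B →+* B')
    (hh : ∀ k b, h (k ⊗ₜ b) = algebraMap κ' B' k * β b)
    (s : C ⊗[A] A') : mkB' (σ s) = h (g s) := by
  induction s using TensorProduct.induction_on with
  | zero => simp only [map_zero]
  | tmul c a' =>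
    have e : (c ⊗ₜ[A] a' : C ⊗[A] A') = (c ⊗ₜ[A] (1 : A')) * ((1 : C) ⊗ₜ[A] a') := by
      rw [Algebra.TensorProduct.tmul_mul_tmul, mul_one, one_mul]
    rw [hg, hh, hικ', hβ, e, map_mul, map_mul, h1, h2, mul_comm]
  | add x y hx hy => simp only [map_add, hx, hy]

end FibreRing

/-! ## The main localisation statement and its completion -/

section Main

variable {A C A' : Type u} [CommRing A] [CommRing C] [CommRing A'] [Algebra A C] [Algebra A A']
  {R O R' O' : Type u} [CommRing R] [CommRing O] [CommRing R'] [CommRing O']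
  [IsLocalRing O] [IsLocalRing R'] [IsLocalRing O']
  (φ : R →+* O) (ρ : R →+* R') (φ' : R' →+* O') (π : O →+* O') [IsLocalHom π]
  (γA : A →+* R) (γC : C →+* O) (γA' : A' →+* R') (σ : C ⊗[A] A' →+* O')
  {κ κ' B B' : Type u} [CommRing κ] [CommRing κ'] [CommRing B] [CommRing B'] [IsLocalRing B']
  [Algebra κ κ'] [Algebra κ B] [Algebra κ' B'] [Algebra κ B'] [IsScalarTower κ κ' B']
  (mkκ : R →+* κ) (mkκ' : R' →+* κ') (mkB : O →+* B) (mkB' : O' →+* B') [IsLocalHom mkB']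
  (β : B →+* B')
  (hsq : ∀ r, φ' (ρ r) = π (φ r))
  (h0a : ∀ a, γC (algebraMap A C a) = φ (γA a)) (h0b : ∀ a, γA' (algebraMap A A' a) = ρ (γA a))
  (h1 : ∀ c, σ (c ⊗ₜ 1) = π (γC c)) (h2 : ∀ a', σ (1 ⊗ₜ a') = φ' (γA' a'))
  (hO : ∀ o : O, ∃ c₁ c₂ : C, IsUnit (γC c₂) ∧ o * γC c₂ = γC c₁)
  (hR' : ∀ r : R', ∃ a₁ a₂ : A', IsUnit (γA' a₂) ∧ r * γA' a₂ = γA' a₁)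
  (hR'' : maximalIdeal R' ≤ ((maximalIdeal R').comap γA').map γA')
  (hO'₁ : ∀ o : O', ∃ s u, IsUnit (σ u) ∧ o * σ u = σ s)
  (hO'₂ : ∀ (I : Ideal (C ⊗[A] A')) (s), σ s ∈ I.map σ → ∃ u, IsUnit (σ u) ∧ u * s ∈ I)
  (hmkκ : Function.Surjective mkκ) (hmkκ' : Function.Surjective mkκ')
  (hkerκ' : ∀ r ∈ maximalIdeal R', mkκ' r = 0)
  (hmkB : Function.Surjective mkB) (hmkB' : Function.Surjective mkB')
  (hkerB' : ∀ o, mkB' o = 0 → o ∈ (maximalIdeal R').map φ')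
  (hκκ' : ∀ r, algebraMap κ κ' (mkκ r) = mkκ' (ρ r)) (hκB : ∀ r, algebraMap κ B (mkκ r) = mkB (φ r))
  (hικ' : ∀ r', algebraMap κ' B' (mkκ' r') = mkB' (φ' r')) (hβ : ∀ o, β (mkB o) = mkB' (π o))
  (hP : (((maximalIdeal O).map mkB).map (tensorInr κ κ' B)).IsMaximal)

include hsq h0a h0b h1 h2 hO hR' hR'' hO'₁ hO'₂ hmkκ hmkκ' hkerκ' hmkB hmkB' hkerB' hκκ' hκB hικ' hβ hP in
/-- **The fibre local ring of a base change is a localisation of `κ' ⊗_κ B`.** In the situation of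
the module docstring (a point `x'` of `X ×_Y Y'` over `x`, `y'`, `y`; `B = 𝒪_x/𝔪_y𝒪_x`,
`B' = 𝒪_{x'}/𝔪_{y'}𝒪_{x'}`, `κ = κ(y)`, `κ' = κ(y')`, the local rings being localisations of the
sections of affine charts and `𝒪_{x'}` a localisation of `Γ(X,U) ⊗_{Γ(Y,V)} Γ(Y',V')` compatibly
with the stalk maps), if the extended ideal `𝔫(κ' ⊗_κ B)` of `𝔫 = 𝔪_x B` is maximal then
`B' = (κ' ⊗_κ B)_{𝔫(κ' ⊗_κ B)}` through `k' ⊗ b ↦ k' b` (localisation criterion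
`isLocalization_atPrime_of_generators` along `Γ(X,U) ⊗ Γ(Y',V') → κ' ⊗_κ B → B'`).
[cite: DeJong1997, 5.7 and p. 614–615] -/
theorem exists_isLocalization_fibreRing :
    ∃ h : κ' ⊗[κ] B →+* B', (∀ k b, h (k ⊗ₜ b) = algebraMap κ' B' k * β b) ∧
      (letI := h.toAlgebra
       IsLocalization.AtPrime B' (((maximalIdeal O).map mkB).map (tensorInr κ κ' B))) := by
  obtain ⟨h, hh⟩ := exists_fibreRing_hom φ ρ φ' π mkκ mkκ' mkB mkB' β hsq hmkκ hκκ' hκB hικ' hβ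
  obtain ⟨g, hg⟩ := exists_fibreRing_g φ ρ γA γC γA' (κ' := κ') mkκ mkκ' mkB h0a h0b hκκ' hκB
  refine ⟨h, hh, ?_⟩
  letI := h.toAlgebra
  set P : Ideal (κ' ⊗[κ] B) := ((maximalIdeal O).map mkB).map (tensorInr κ κ' B) with hPdef
  have hcomm : ∀ s, mkB' (σ s) = h (g s) :=
    fibreRing_comm φ' π γC γA' σ mkκ' mkB mkB' β h1 h2 hικ' hβ g hg h hh
  -- `P` is the preimage of `𝔪_{B'}`
  have hPle : P ≤ (maximalIdeal B').comap h := by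
    rw [hPdef, Ideal.map_le_iff_le_comap, Ideal.map_le_iff_le_comap]
    intro o ho
    rw [Ideal.mem_comap, Ideal.mem_comap, tensorInr_apply, Ideal.mem_comap, hh, map_one, one_mul, hβ]
    have hπ : (maximalIdeal O).map π ≤ maximalIdeal O' := ((local_hom_TFAE π).out 0 2).mp ‹IsLocalHom π›
    have hmk : (maximalIdeal O').map mkB' ≤ maximalIdeal B' :=
      ((local_hom_TFAE mkB').out 0 2).mp ‹IsLocalHom mkB'›
    exact hmk (Ideal.mem_map_of_mem mkB' (hπ (Ideal.mem_map_of_mem π ho)))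
  have hPeq : P = (maximalIdeal B').comap h :=
    hP.eq_of_le (Ideal.comap_ne_top h (maximalIdeal.isMaximal B').ne_top) hPle
  haveI : P.IsPrime := hP.isPrime
  have hunit : ∀ s, IsUnit (σ s) → IsUnit (h (g s)) := fun s hs => by
    rw [← hcomm]; exact hs.map mkB'
  refine isLocalization_atPrime_of_generators g ((IsUnit.submonoid O').comap σ) P
    (fun s hs hsP => ?_) (fun t => ?_) (fun l => ?_) (fun s hs => ?_) (fun t ht => ?_)
  · -- (a) `g(N) ∩ P = ∅`
    rw [Submonoid.mem_comap, IsUnit.mem_submonoid_iff] at hs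
    have hm : h (g s) ∈ maximalIdeal B' := by rw [hPeq] at hsP; exact hsP
    exact (mem_nonunits_iff.mp ((IsLocalRing.mem_maximalIdeal _).mp hm)) (hunit s hs)
  · -- (b) generators of `κ' ⊗ B`
    obtain ⟨s, u, hu, e⟩ := fibreRing_generators φ' π γC γA' σ mkκ' mkB h1 h2 hO hR' hmkκ' hmkB g hg t
    exact ⟨s, u, by rwa [Submonoid.mem_comap, IsUnit.mem_submonoid_iff], e⟩
  · -- (c) generators of `B'`
    obtain ⟨o, rfl⟩ := hmkB' l
    obtain ⟨s, u, hu, e⟩ := hO'₁ o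
    refine ⟨s, u, by rwa [Submonoid.mem_comap, IsUnit.mem_submonoid_iff], ?_⟩
    change mkB' o * h (g u) = h (g s)
    rw [← hcomm, ← hcomm, ← map_mul, e]
  · -- (d) the kernel
    change h (g s) = 0 at hs
    rw [← hcomm] at hs
    have hmem : σ s ∈ (((maximalIdeal R').comap γA').map
        (Algebra.TensorProduct.includeRight (R := A) (A := C) (B := A')).toRingHom).map σ := by
      rw [Ideal.map_map]
      have hc : σ.comp (Algebra.TensorProduct.includeRight (R := A) (A := C) (B := A')).toRingHom =
          φ'.comp γA' := RingHom.ext fun a' => h2 a'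
      rw [hc, ← Ideal.map_map]
      exact Ideal.map_mono hR'' (hkerB' _ hs)
    obtain ⟨u, hu, hus⟩ := hO'₂ _ s hmem
    refine ⟨u, by rwa [Submonoid.mem_comap, IsUnit.mem_submonoid_iff], ?_⟩
    have hle : (((maximalIdeal R').comap γA').map
        (Algebra.TensorProduct.includeRight (R := A) (A := C) (B := A')).toRingHom).map g ≤ ⊥ := by
      rw [Ideal.map_map, Ideal.map_le_iff_le_comap]
      intro a' ha'
      rw [Ideal.mem_comap, RingHom.comp_apply, AlgHom.toRingHom_eq_coe, RingHom.coe_coe,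
        Algebra.TensorProduct.includeRight_apply, hg, hkerκ' _ (Ideal.mem_comap.mp ha'),
        TensorProduct.zero_tmul]
      exact Ideal.zero_mem _
    exact (Ideal.mem_bot.mp (hle (Ideal.mem_map_of_mem g hus)))
  · -- (e) units
    rw [hPeq, Ideal.mem_comap] at ht
    by_contra hn
    exact ht ((IsLocalRing.mem_maximalIdeal _).mpr (mem_nonunits_iff.mpr hn))

include hsq h0a h0b h1 h2 hO hR' hR'' hO'₁ hO'₂ hmkκ hmkκ' hkerκ' hmkB hmkB' hkerB' hκκ' hκB hικ' hβ hP in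
/-- **The completed fibre local ring of a base change**: in the situation of
`exists_isLocalization_fibreRing`, `(B')^` at `𝔪_{x'}B'` is the completion of `κ' ⊗_κ B` at the
maximal ideal `𝔫(κ' ⊗_κ B)`, compatibly with `κ'` (`adicCompletionEquivOfIsLocalizationAtMaximal`:
the completion of a localisation at a maximal ideal is the completion at that ideal); so every
presentation `(κ' ⊗_κ B)^ ≅ Λ` over `κ'` (e.g. `Λ = κ'⟦u,v⟧/(uv)`,
`exists_completion_tensor_equiv_nodeQuot`) yields `(B')^ ≅ Λ` over `κ'`.
[cite: DeJong1997, 5.7 and p. 614–615] -/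
theorem exists_adicCompletion_fibreRing_equiv {Λ : Type u} [CommRing Λ] [Algebra κ' Λ]
    (e' : AdicCompletion (((maximalIdeal O).map mkB).map (tensorInr κ κ' B)) (κ' ⊗[κ] B) ≃+* Λ)
    (he' : ∀ c, e' (algebraMap κ' _ c) = algebraMap κ' Λ c) :
    ∃ e : AdicCompletion ((maximalIdeal O').map mkB') B' ≃+* Λ,
      ∀ c : κ', e (algebraMap B' _ (algebraMap κ' B' c)) = algebraMap κ' Λ c := by
  obtain ⟨h, hh, hloc⟩ := exists_isLocalization_fibreRing φ ρ φ' π γA γC γA' σ mkκ mkκ' mkB mkB' β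
    hsq h0a h0b h1 h2 hO hR' hR'' hO'₁ hO'₂ hmkκ hmkκ' hkerκ' hmkB hmkB' hkerB' hκκ' hκB hικ' hβ hP
  letI := h.toAlgebra
  haveI := hP
  haveI : IsLocalization.AtPrime B' (((maximalIdeal O).map mkB).map (tensorInr κ κ' B)) := hloc
  -- `𝔪_{x'} B' = 𝔪_{B'}`
  have hn' : (maximalIdeal O').map mkB' = maximalIdeal B' := by
    have hc : (maximalIdeal B').comap mkB' = maximalIdeal O' :=
      ((local_hom_TFAE mkB').out 0 4).mp ‹IsLocalHom mkB'›
    rw [← hc, Ideal.map_comap_of_surjective mkB' hmkB']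
  let E₀ : AdicCompletion ((maximalIdeal O').map mkB') B' ≃+* LocalCpl B' :=
    adicCompletionCongr _ _ (RingEquiv.refl B') (by rw [hn']; exact Ideal.map_id _)
  let E₁ : AdicCompletion (((maximalIdeal O).map mkB).map (tensorInr κ κ' B)) (κ' ⊗[κ] B) ≃+* LocalCpl B' :=
    adicCompletionEquivOfIsLocalizationAtMaximal _ B'
  refine ⟨E₀.trans (E₁.symm.trans e'), fun c => ?_⟩
  have e1 : E₀ (algebraMap B' _ (algebraMap κ' B' c)) = AdicCompletion.of _ B' (algebraMap κ' B' c) := by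
    change E₀ (AdicCompletion.of _ B' (algebraMap κ' B' c)) = _
    simp only [E₀]
    rw [adicCompletionCongr_of]
    rfl
  have e2 : E₁ (algebraMap κ' (AdicCompletion (((maximalIdeal O).map mkB).map (tensorInr κ κ' B))
      (κ' ⊗[κ] B)) c) = AdicCompletion.of _ B' (algebraMap κ' B' c) := by
    rw [AdicCompletion.algebraMap_apply, Algebra.TensorProduct.algebraMap_apply, Algebra.algebraMap_self,
      RingHom.id_apply]
    simp only [E₁]
    rw [adicCompletionEquivOfIsLocalizationAtMaximal_of]
    congr 1
    change h (c ⊗ₜ 1) = _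
    rw [hh, map_one, mul_one]
  rw [RingEquiv.trans_apply, RingEquiv.trans_apply, e1, ← e2, RingEquiv.symm_apply_apply, he']

end Main

end Summit.ResolutionOfSingularities.ResolutionOfSingularities.Theorems

end
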